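import Literature.NumberTheory.EllipticCurves.Rank1Residual.Typed.SelmerCardCertificate
import Literature.NumberTheory.EllipticCurves.CasselsTateParity
import Literature.NumberTheory.EllipticCurves.ZpCorankQuasiIso
import Summits.BirchSwinnertonDyer.Rank1Residual.X11b.ChaPairsMinimality
import HarnessLib

/-!
# BSD rank-≤1 residual cell, class X11b: the `p`-descent certificate needs only
# `#Sel^(p)(E/K) < p^{rank + 2}` (Cassels–Tate parity)

HONEST FRAMING (cell `b2b-bsdres-*`, verbatim): prove what is provable now; shrink each hard class
to its core with data; no claim beyond stated classes; COMBINATION classes deleted from PUBLISHED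
theorems only, CONSTRUCTION-shaped remainder typed; this is not "finishing BSD". Class X11b stays
CONSTRUCTION-SHAPED; everything here is PER PAIR; no lane verdict is changed; no named fact is minted.

Unit `b2b-bsdres-x11c`, gen 13. The exact `p`-descent certificate consumed by the tree's class-free
`Literature.NumberTheory.EllipticCurves.Rank1Residual.Typed.bsdp_of_card_selmerGroup_eq_pow_analyticRank`
asks for the EQUALITY `#Sel^(p)(E/ℚ) = p ^ r_an`. When `Ш(E/K)` is finite, the Cassels–Tate pairing
(the tree's PUBLISHED named fact `WeierstrassCurve.exists_casselsTate_pairing`, bsd.S18: Cassels 1962,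
Tate 1963, Silverman AEC X.4.14; consumed as the hypothesis `hCT`, exactly as in
`Literature.NumberTheory.EllipticCurves.CasselsTateParity`) makes `dim_{𝔽_p} Ш(E/K)[p]` EVEN
(`exists_natCard_modN_primaryComponent_sha` + `#A[p] = #(A/pA)` for the finite group `A = Ш[p^∞]`),
so the fundamental exact sequence `0 → E(K)/p → Sel^(p) → Ш[p] → 0` (`selmer_exact_holds`, PROVED)
and Mordell–Weil (`p ^ rank ∣ #E(K)/pE(K)`) give: **`#Sel^(p)(E/K) < p ^ (rank + 2)` already forces
`Ш(E/K)[p] = 0`** (`noPTorsion_of_card_selmerGroup_lt_of_casselsTate`). The rank-`≤ 1` consumer over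
`ℚ` (`bsdp_of_card_selmerGroup_le_of_casselsTate`: GZK gives `rank = r_an` and `Ш` finite; Miller's last
clause) therefore needs from a `p`-descent only the INEQUALITY `dim_𝔽_p Sel^(p)(E/ℚ) ≤ r_an + 1` —
one dimension of slack, which is what makes a descent with an uncertified piece (one class-group
generator, or a one-dimensional `K_S(R)` in the unit's `5S4` engine, `HOME/b2b-bsdres-x11c/gen13/
S4DESCENT-METHOD.md` §4) still conclusive. Our own lemma (Summits side); PUBLISHED inputs are the two
binders `hCT`, `hGZK`; nothing here is a class theorem.

References: J. W. S. Cassels, *Arithmetic on curves of genus 1, IV*, J. reine angew. Math. 211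
(1962) [Cassels1962ArithmeticIV]; J. H. Silverman, *AEC* (2009) Thm X.4.14, Thm X.4.2
[SilvermanAEC2009]; R. L. Miller, LMS JCM 14 (2011) §1 [Miller2011LMS].
-/

set_option linter.dupNamespace false
set_option autoImplicit false

noncomputable section

open scoped Classical AddSubgroup

open WeierstrassCurve Literature.NumberTheory.EllipticCurves
  Literature.NumberTheory.EllipticCurves.Rank1Residual
  Literature.NumberTheory.EllipticCurves.Rank1Residual.Typed
  Literature.NumberTheory.EllipticCurves.Rank1Residual.X11RankOneCertificates
  Literature.GroupTheory.FiniteAbelian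

namespace Summit.BirchSwinnertonDyer.Rank1Residual.X11b

universe u

section General

variable {K : Type u} [Field K] [NumberField K] (W : WeierstrassCurve K) [W.IsElliptic]

/-- **Parity form of the `p`-descent certificate.** For an elliptic curve `E/K` over a number
field with `Ш(E/K)` finite, granting the Cassels–Tate pairing (`hCT`, bsd.S18): if
`#Sel^(p)(E/K) = p ^ k` with `k < rank_ℤ E(K) + 2`, then `Ш(E/K)[p] = 0`. Proof:
`#Sel^(p) = #(E(K)/pE(K)) · #Ш[p]` (fundamental exact sequence, `selmer_exact_holds`),
`p ^ rank ∣ #(E(K)/pE(K))` (Mordell–Weil), so `#Ш[p] < p²`; and `#Ш[p] = #(A/pA) = p^{2m}` for the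
finite group `A = Ш(E/K)[p^∞]` (Cassels–Tate alternation, `exists_natCard_modN_primaryComponent_sha`),
whence `m = 0`. [cite: SilvermanAEC2009, Thm X.4.14 and Thm X.4.2] -/
theorem noPTorsion_of_card_selmerGroup_lt_of_casselsTate
    (hCT : exists_casselsTate_pairing (K := K)) (p : ℕ) [hp : Fact p.Prime] [Finite W.sha]
    {k : ℕ} (hcard : Nat.card (W.selmerGroup (p : ℤ)) = p ^ k) (hk : k < W.mordellWeilRank + 2) :
    ∀ x : W.sha, (p : ℤ) • x = 0 → x = 0 := by
  have hp0 : (p : ℤ) ≠ 0 := by exact_mod_cast hp.out.ne_zero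
  have hp1 : 1 < p := hp.out.one_lt
  haveI : NeZero p := ⟨hp.out.ne_zero⟩
  obtain ⟨κ, hker, hrange, hmap⟩ := selmer_exact_holds W (p : ℤ) hp0
  haveI : Module.Finite ℤ W.toAffine.Point := W.module_finite_point_holds
  set S : AddSubgroup (W.galH1Torsion (p : ℤ)) := W.selmerGroup (p : ℤ) with hSdef
  set f := W.torsionH1ToH1 (p : ℤ) with hfdef
  -- `Sel` is finite
  haveI hfinS : Finite S :=
    Nat.finite_of_card_ne_zero (by rw [hcard]; exact pow_ne_zero _ hp.out.ne_zero)
  -- `p ^ rank ∣ #κ.range`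
  have hdvd1 : p ^ W.mordellWeilRank ∣ Nat.card κ.range := by
    have h := pow_finrank_dvd_natCard_quotient_range_zsmul (A := W.toAffine.Point) p
    have hequiv : Nat.card (W.toAffine.Point ⧸
        (zsmulAddGroupHom (α := W.toAffine.Point) (p : ℤ)).range) = Nat.card κ.range := by
      rw [← hker]
      exact Nat.card_congr (QuotientAddGroup.quotientKerEquivRange κ).toEquiv
    rw [hequiv] at h
    exact h
  have hleS : κ.range ≤ S := by rw [hrange]; exact inf_le_left
  haveI : Finite κ.range := Finite.of_injective (AddSubgroup.inclusion hleS)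
    (AddSubgroup.inclusion_injective hleS)
  -- the restriction `g = f|_Sel` : `#Sel = #ker g · #range g`, `ker g ≅ Sel ⊓ ker f = κ.range`,
  -- `range g = Sel.map f = Ш ⊓ (p-torsion)`
  let g : S →+ W.galH1 := f.comp S.subtype
  have hgrange : g.range = S.map f := by
    rw [AddMonoidHom.range_comp, AddSubgroup.range_subtype]
  have hgker : g.ker = (S ⊓ f.ker).addSubgroupOf S := by
    rw [AddSubgroup.inf_addSubgroupOf_left]
    ext x
    simp only [AddMonoidHom.mem_ker, AddSubgroup.mem_addSubgroupOf, g, AddMonoidHom.coe_comp,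
      AddSubgroup.coe_subtype, Function.comp_apply]
  have hcardker : Nat.card g.ker = Nat.card κ.range := by
    rw [hgker, hrange]
    exact Nat.card_congr (AddSubgroup.addSubgroupOfEquivOfLe (inf_le_left : S ⊓ f.ker ≤ S)).toEquiv
  have hcardS : Nat.card S = Nat.card κ.range * Nat.card (S.map f) := by
    rw [← hcardker, ← hgrange]
    exact natCard_eq_card_ker_mul_card_range g
  -- hence `#(Ш ⊓ p-torsion) < p ^ 2`
  haveI hfinT : Finite (S.map f) := by
    rw [← hgrange]
    exact Finite.of_surjective g.rangeRestrict g.rangeRestrict_surjective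
  have hTlt : Nat.card (S.map f) < p ^ 2 := by
    have h1 : p ^ W.mordellWeilRank * Nat.card (S.map f) ≤ Nat.card κ.range * Nat.card (S.map f) :=
      Nat.mul_le_mul_right _ (Nat.le_of_dvd Nat.card_pos hdvd1)
    rw [← hcardS, hcard] at h1
    have h2 : p ^ W.mordellWeilRank * Nat.card (S.map f) < p ^ W.mordellWeilRank * p ^ 2 := by
      calc p ^ W.mordellWeilRank * Nat.card (S.map f) ≤ p ^ k := h1
        _ < p ^ (W.mordellWeilRank + 2) := Nat.pow_lt_pow_right hp1 hk
        _ = p ^ W.mordellWeilRank * p ^ 2 := by rw [pow_add]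
    exact Nat.lt_of_mul_lt_mul_left h2
  -- `A = Ш[p^∞]` is finite and `A[p]` injects into `Sel.map f = Ш ⊓ (p-torsion of H¹(K,E))`
  have hT : S.map f = W.sha ⊓ AddSubgroup.torsionBy W.galH1 (p : ℤ) := by
    simpa only [hSdef, hfdef] using hmap
  set A : AddSubgroup W.sha := AddCommGroup.primaryComponent W.sha p with hAdef
  haveI : Finite A := inferInstance
  let ι : (↥A)[(p : ℤ)] → S.map f := fun a ↦ ⟨((a : A) : W.sha), by
    rw [hT]
    refine AddSubgroup.mem_inf.mpr ⟨((a : A) : W.sha).2, ?_⟩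
    rw [AddSubgroup.torsionBy.nsmul_iff, ← natCast_zsmul]
    have ha : (p : ℤ) • (a : A) = 0 := (Submodule.mem_torsionBy_iff _ _).mp a.2
    have h2 := congrArg (fun z : A ↦ ((z : W.sha) : W.galH1)) ha
    simpa only [AddSubgroupClass.coe_zsmul, ZeroMemClass.coe_zero] using h2⟩
  have hι : Function.Injective ι := by
    intro a b hab
    have h := congrArg (fun z : S.map f ↦ (z : W.galH1)) hab
    exact Subtype.ext (Subtype.ext (Subtype.ext h))
  have hAle : Nat.card (↥A)[(p : ℤ)] ≤ Nat.card (S.map f) := Nat.card_le_card_of_injective ι hι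
  -- Cassels–Tate: `#A[p] = #(A/pA) = p^(2m)`, so `m = 0`
  obtain ⟨m, hm⟩ := exists_natCard_modN_primaryComponent_sha W p hCT
  have hAp : Nat.card (↥A)[(p : ℤ)] = p ^ (2 * m) := by
    rw [natCard_torsionBy_eq_natCard_modN p]
    simpa only [hAdef] using hm
  have hm0 : m = 0 := by
    by_contra hne
    have h1 : p ^ 2 ≤ p ^ (2 * m) := Nat.pow_le_pow_right hp.out.pos (by omega)
    have := lt_of_le_of_lt (h1.trans (hAp ▸ hAle)) hTlt
    exact lt_irrefl _ this
  have hbot : (↥A)[(p : ℤ)] = ⊥ :=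
    AddSubgroup.eq_bot_of_card_eq _ (by rw [hAp, hm0, mul_zero, pow_zero])
  -- conclude
  intro x hx
  have hxA : x ∈ A := by
    rw [hAdef, AddCommGroup.mem_primaryComponent]
    exact ⟨1, by rw [pow_one, ← natCast_zsmul]; exact hx⟩
  have hxt : (⟨x, hxA⟩ : A) ∈ (↥A)[(p : ℤ)] := by
    refine (Submodule.mem_torsionBy_iff _ _).mpr (Subtype.ext ?_)
    simpa only [AddSubgroupClass.coe_zsmul, ZeroMemClass.coe_zero] using hx
  rw [hbot, AddSubgroup.mem_bot] at hxt
  exact congrArg (fun z : A ↦ (z : W.sha)) hxt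

end General

section OverQ

variable (W : WeierstrassCurve ℚ) [W.IsElliptic] (p : ℕ) [Fact p.Prime]

/-- **`BSD(E,p)` in analytic rank `≤ 1` at a pair with `p ∤ #Ш_an`, from the INEQUALITY
`#Sel^(p)(E/ℚ) = p ^ k`, `k ≤ r_an + 1`** (one dimension of slack over the exact certificate
`bsdp_of_card_selmerGroup_eq_pow_analyticRank`), granting the Cassels–Tate pairing `hCT` (bsd.S18)
and Gross–Zagier–Kolyvagin `hGZK` (bsd.S17: `rank = r_an`, `Ш` finite); Miller's last clause via
`bsdp_of_shaAn_unit_of_noPTorsion`. Class-free; PUBLISHED inputs + a per-curve certificate; not a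
class theorem. [cite: Miller2011LMS, §1 and Def. 1.1] [cite: SilvermanAEC2009, Thm X.4.14] -/
theorem bsdp_of_card_selmerGroup_le_of_casselsTate (hCT : exists_casselsTate_pairing (K := ℚ))
    (hGZK : rank_eq_analyticRank_of_analyticRank_le_one) (hr : W.analyticRank ≤ 1) {q : ℚ}
    (hq : shaAn W = (q : ℂ)) (hv : padicValRat p q = 0) {k : ℕ}
    (hcard : Nat.card (W.selmerGroup (p : ℤ)) = p ^ k) (hk : k ≤ W.analyticRank + 1) :
    BSDp W p := by
  have hrank : W.mordellWeilRank = W.analyticRank := (hGZK W hr).1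
  haveI : Finite W.sha := (hGZK W hr).2
  exact bsdp_of_shaAn_unit_of_noPTorsion W p hGZK hr hq hv
    (noPTorsion_of_card_selmerGroup_lt_of_casselsTate W hCT p hcard (by rw [hrank]; omega))

/-- **Literal-model instantiation** (for certificate files): `BSD(E,p)` for the curve with integer
model `[a₁,…,a₆]` (`Δ ≠ 0` decidable via `discOf`) at a pair with `r_an ≤ 1`, `p ∤ #Ш_an` and a
`p`-descent giving `#Sel^(p)(E/ℚ) = p ^ k`, `k ≤ r_an + 1`; binders `hCT`, `hGZK` (published).
[cite: Miller2011LMS, §1 and Def. 1.1] [cite: SilvermanAEC2009, Thm X.4.14] -/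
theorem bsdp_of_ainvs_of_card_selmerGroup_le_of_casselsTate
    (hCT : exists_casselsTate_pairing (K := ℚ)) (hGZK : rank_eq_analyticRank_of_analyticRank_le_one)
    (a1 a2 a3 a4 a6 : ℤ) (hΔ : discOf [a1, a2, a3, a4, a6] ≠ 0)
    (p : ℕ) [Fact p.Prime]
    (hr : (⟨a1, a2, a3, a4, a6⟩ : WeierstrassCurve ℚ).analyticRank ≤ 1) {q : ℚ}
    (hq : shaAn (⟨a1, a2, a3, a4, a6⟩ : WeierstrassCurve ℚ) = (q : ℂ)) (hv : padicValRat p q = 0)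
    {k : ℕ} (hcard : Nat.card ((⟨a1, a2, a3, a4, a6⟩ : WeierstrassCurve ℚ).selmerGroup (p : ℤ)) = p ^ k)
    (hk : k ≤ (⟨a1, a2, a3, a4, a6⟩ : WeierstrassCurve ℚ).analyticRank + 1) :
    BSDp (⟨a1, a2, a3, a4, a6⟩ : WeierstrassCurve ℚ) p := by
  haveI := isElliptic_of_discOf_ne_zero a1 a2 a3 a4 a6 hΔ
  exact bsdp_of_card_selmerGroup_le_of_casselsTate _ p hCT hGZK hr hq hv hcard hk

end OverQ

end Summit.BirchSwinnertonDyer.Rank1Residual.X11b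

end
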